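import Summits.BirchSwinnertonDyer.BirchSwinnertonDyer.Theorems.Rank2ObservatoryRank3WitnessT4
import Summits.BirchSwinnertonDyer.BirchSwinnertonDyer.Theorems.Rank2ObservatoryKernelWalker
import HarnessLib

/-!
# BirchSwinnertonDyer — rank ≥ 2 observatory: rank-3 saturation, torsion clauses + shifted witnesses

HONEST FRAMING: per-curve certified theorems and census instruments; no claim on BSD in rank ≥ 2.

The rank-3 SATURATION census (`Rank2ObservatoryRank3SatCensus*`: base Boolean `rank3SatCheck`,
variant T `rank3SatCheckT`) leaves 30 rows of `rank3Table` in the listed residual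
`satSkippedRows`: the rows whose RANK certificate needed one of the torsion supplements of
`Rank2ObservatoryRank3WitnessT2/T3/T4` (files `…Rank3KernelCertsU*/V*/W*`) — U: the curve has a
rational `2`-torsion point `T` that is a double modulo every small good prime although `E(ℚ)` has
no point of order `4`, so the `2`-exponent of the count annihilator `t = 2^e·m` is lowered to
`u = 1` by `T = (x_T, y_T)`, a good odd prime `ℓ₁` at which `T̃` is the only `2`-torsion point
(`twoTorsionOnlyB`) and a good prime `ℓ₂` at which `T̃` is no double (`xDoubleFree`); V: the same
torsion clause, and the seven coset tests are run modulo the RATIONAL `2`-torsion `{O, T}` only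
(`tCosetFree`: `R̃ ∉ 2Ẽ(𝔽_q)` and `R̃ + T̃ ∉ 2Ẽ(𝔽_q)`); W: `E(ℚ)[4] = {O, ±T₄, T}` certified by
an integer tangent `2T₄ = T` (`intTangent`), `twoTorsionOnlyB` and `halfTOnlyB` at one good odd
prime, annihilator `t = 4m`, coset tests `tCosetFree` w.r.t. `T̃₄` at `2`-exponent `u = 2`.

This file is the first half of the generic layer that upgrades those rank certificates to
`2`-SATURATION certificates in the tabulated (row-Boolean) style of
`Rank2ObservatoryRank3SatCert[B|T]` (second half: `Rank2ObservatoryRank3SatCertS`):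

* torsion clauses as Booleans with the primes as DATA (`q = 0` rejected by pattern matching):
  `twoTorsionPointB` (`T` on the model, `2y_T + a₁x_T + a₃ = 0`, `ℓ₁` good odd, `twoTorsionOnlyB`),
  `notDoubleB` (`ℓ₂` good, `xDoubleFree` at `x_T`), `fourTorsionPointB` (`T`, `T₄` on the model,
  `intTangent`, `ℓ₁` good odd, `twoTorsionOnlyB`, `halfTOnlyB`), with soundness
  `torsion_zsmul_eq_zero_of_twoTorsionPointB` (`2m · E(ℚ)_tors = 0`),
  `twoTorsion_of_twoTorsionPointB` (`E(ℚ)[2] ⊆ {O, T}`), `fourTorsion_of_fourTorsionPointB`;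
* SHIFTED coset witnesses with the prime as a datum: `tWitnessB` / `tWitness₂B` / `tWitness₃B`
  (good prime, chords `zmodChord` for the sums, `tCosetFree` w.r.t. the shift point), sound for
  any `2`-exponent `u` under the inline LANE HYPOTHESIS `hL`
  (`not_mem_twoCoset_of_tWitnessB/₂B/₃B`), which holds for `u = 1`, shift `T`
  (`tShiftLane_one`, from `not_mem_twoCoset_one_of_tCosetFree`) and for `u = 2`, shift `T₄`
  (`tShiftLane_two`, from `not_mem_twoCoset_two_of_tCosetFree`).

Sorry-free; no `native_decide`; no instances, no notation.

References: Cremona, *Algorithms for Modular Elliptic Curves* (1997) §3.5; Siksek, Rocky Mountain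
J. Math. 25 (1995); Silverman, *The Arithmetic of Elliptic Curves* (2009) III.2.3, VII.3.1(b),
VIII.6.7.
-/

-- single-conjunct summit: `Summit.BirchSwinnertonDyer.BirchSwinnertonDyer.…` repeats the name
set_option linter.dupNamespace false

open WeierstrassCurve

namespace Summit.BirchSwinnertonDyer.BirchSwinnertonDyer.Rank2Observatory

open Literature.NumberTheory.EllipticCurves

/-- Soundness of the walker's `goodPrimeB` (unfolded). [folklore] -/
private theorem goodPrimeB_sound {V : WeierstrassCurve ℤ} {q : ℕ} (h : goodPrimeB V q = true) :
    q.Prime ∧ ¬ (q : ℤ) ∣ V.Δ := by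
  simpa only [goodPrimeB, Bool.and_eq_true, decide_eq_true_eq] using h

/-! ### Torsion clauses with the primes as data -/

/-- TORSION CLAUSE `T` (a Boolean for `decide`): `(x_T, y_T)` is an integral point of `V` with
`2y_T + a₁x_T + a₃ = 0` (a rational `2`-torsion point), `ℓ₁` is a good ODD prime and `T̃` is the
only affine `2`-torsion point of `Ẽ(𝔽_ℓ₁)` (`twoTorsionOnlyB`); `ℓ₁ = 0` rejected.
[cite: SilvermanAEC2009, Prop. VII.3.1(b)] -/
def twoTorsionPointB (V : WeierstrassCurve ℤ) (xT yT : ℤ) : ℕ → Bool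
  | 0 => false
  | ℓ + 1 =>
      decide (yT ^ 2 + V.a₁ * xT * yT + V.a₃ * yT = xT ^ 3 + V.a₂ * xT ^ 2 + V.a₄ * xT + V.a₆ ∧
          2 * yT + V.a₁ * xT + V.a₃ = 0 ∧ ℓ + 1 ≠ 2) &&
        goodPrimeB V (ℓ + 1) && twoTorsionOnlyB V (ℓ + 1) xT yT

/-- NO-DOUBLE CLAUSE (a Boolean for `decide`): `ℓ₂` is a good prime and `x_T` is not the abscissa
of a double in `Ẽ(𝔽_ℓ₂)` (`xDoubleFree`), so `T ∉ 2E(ℚ)`; `ℓ₂ = 0` rejected.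
[cite: SilvermanAEC2009, Prop. VII.3.1(b)] -/
def notDoubleB (V : WeierstrassCurve ℤ) (xT : ℤ) : ℕ → Bool
  | 0 => false
  | ℓ + 1 => goodPrimeB V (ℓ + 1) && xDoubleFree V (ℓ + 1) (xT : ZMod (ℓ + 1))

/-- TORSION CLAUSE `T₄` (a Boolean for `decide`): `T = (x_T, y_T)` and `T₄ = (x₄, y₄)` integral
points of `V`, `2y_T + a₁x_T + a₃ = 0`, `2T₄ = T` by the integer tangent certificate `intTangent`,
`ℓ₁` a good odd prime with `twoTorsionOnlyB` and `halfTOnlyB` (`E(ℚ)[4] = {O, ±T₄, T}`);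
`ℓ₁ = 0` rejected. [cite: SilvermanAEC2009, Prop. VII.3.1(b)] -/
def fourTorsionPointB (V : WeierstrassCurve ℤ) (xT yT x₄ y₄ : ℤ) : ℕ → Bool
  | 0 => false
  | ℓ + 1 =>
      decide (yT ^ 2 + V.a₁ * xT * yT + V.a₃ * yT = xT ^ 3 + V.a₂ * xT ^ 2 + V.a₄ * xT + V.a₆ ∧
          2 * yT + V.a₁ * xT + V.a₃ = 0 ∧
          y₄ ^ 2 + V.a₁ * x₄ * y₄ + V.a₃ * y₄ = x₄ ^ 3 + V.a₂ * x₄ ^ 2 + V.a₄ * x₄ + V.a₆ ∧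
          ℓ + 1 ≠ 2) &&
        intTangent V x₄ y₄ xT yT && goodPrimeB V (ℓ + 1) && twoTorsionOnlyB V (ℓ + 1) xT yT &&
        halfTOnlyB V (ℓ + 1) xT x₄ y₄

section TorsionSoundness

variable (V : WeierstrassCurve ℤ)

open scoped Classical in
/-- **`2m · E(ℚ)_tors = 0`** from the count annihilator `t = 2^e·m` (`annihilatorCheck`, killers by
`killerB`) and the clauses `twoTorsionPointB`, `notDoubleB` (no rational point of order `4`:
`torsion_zsmul_eq_zero_of_twoTorsionWitness`). [cite: SilvermanAEC2009, Prop. VII.3.1(b)] -/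
theorem torsion_zsmul_eq_zero_of_twoTorsionPointB {S : List (ℕ × ℕ)} {t e m : ℕ}
    (hte : t = 2 ^ e * m) (hann : annihilatorCheck S t = true) (hS : S.all (killerB V) = true)
    {xT yT : ℤ} {ℓ₁ ℓ₂ : ℕ} (h₁ : twoTorsionPointB V xT yT ℓ₁ = true)
    (h₂ : notDoubleB V xT ℓ₂ = true)
    (x : (V.map (Int.castRingHom ℚ)).toAffine.Point) (hx : IsOfFinAddOrder x) :
    ((2 : ℤ) ^ 1 * (m : ℤ)) • x = 0 := by
  cases ℓ₁ with
  | zero => simp [twoTorsionPointB] at h₁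
  | succ ℓ₁ =>
  cases ℓ₂ with
  | zero => simp [notDoubleB] at h₂
  | succ ℓ₂ =>
  simp only [twoTorsionPointB, Bool.and_eq_true, decide_eq_true_eq] at h₁
  simp only [notDoubleB, Bool.and_eq_true] at h₂
  obtain ⟨⟨⟨hT, hT2, hodd⟩, hg₁⟩, hB₁⟩ := h₁
  obtain ⟨hg₂, hB₂⟩ := h₂
  obtain ⟨hp₁, hℓ₁⟩ := goodPrimeB_sound hg₁
  obtain ⟨hp₂, hℓ₂⟩ := goodPrimeB_sound hg₂
  haveI : Fact (ℓ₁ + 1).Prime := ⟨hp₁⟩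
  haveI : Fact (ℓ₂ + 1).Prime := ⟨hp₂⟩
  exact torsion_zsmul_eq_zero_of_twoTorsionWitness V hte (killers_of_all_killerB V hS) hann hT hT2
    (ℓ₁ + 1) hℓ₁ hodd hB₁ (ℓ₂ + 1) hℓ₂ hB₂ x hx

open scoped Classical in
/-- **`E(ℚ)[2] ⊆ {O, T}`** from the clause `twoTorsionPointB` (`twoTorsion_eq_zero_or_eq`); the
point `T` is returned with its integral equation. [cite: SilvermanAEC2009, Prop. VII.3.1(b)] -/
theorem twoTorsion_of_twoTorsionPointB (hΔ : V.Δ ≠ 0) {xT yT : ℤ} {ℓ₁ : ℕ}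
    (h₁ : twoTorsionPointB V xT yT ℓ₁ = true) :
    ∃ hT : yT ^ 2 + V.a₁ * xT * yT + V.a₃ * yT = xT ^ 3 + V.a₂ * xT ^ 2 + V.a₄ * xT + V.a₆,
      ∀ τ : (V.map (Int.castRingHom ℚ)).toAffine.Point, (2 : ℤ) • τ = 0 →
        τ = 0 ∨ τ = Affine.Point.some (xT : ℚ) (yT : ℚ) (nonsingular_rat_of_eq V hΔ hT) := by
  cases ℓ₁ with
  | zero => simp [twoTorsionPointB] at h₁
  | succ ℓ₁ =>
  simp only [twoTorsionPointB, Bool.and_eq_true, decide_eq_true_eq] at h₁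
  obtain ⟨⟨⟨hT, hT2, hodd⟩, hg₁⟩, hB₁⟩ := h₁
  obtain ⟨hp₁, hℓ₁⟩ := goodPrimeB_sound hg₁
  haveI : Fact (ℓ₁ + 1).Prime := ⟨hp₁⟩
  exact ⟨hT, twoTorsion_eq_zero_or_eq V hT hT2 (ℓ₁ + 1) hℓ₁ hodd hB₁⟩

open scoped Classical in
/-- **`E(ℚ)[4] ⊆ {O, T₄, 2T₄, −T₄}`** from the clause `fourTorsionPointB` (`fourTorsion_eq`); the
point `T₄` is returned with its integral equation. [cite: SilvermanAEC2009, Prop. VII.3.1(b)] -/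
theorem fourTorsion_of_fourTorsionPointB (hΔ : V.Δ ≠ 0) {xT yT x₄ y₄ : ℤ} {ℓ₁ : ℕ}
    (h₁ : fourTorsionPointB V xT yT x₄ y₄ ℓ₁ = true) :
    ∃ h₄ : y₄ ^ 2 + V.a₁ * x₄ * y₄ + V.a₃ * y₄ = x₄ ^ 3 + V.a₂ * x₄ ^ 2 + V.a₄ * x₄ + V.a₆,
      haveI := isElliptic_rat V hΔ
      ∀ τ : (V.map (Int.castRingHom ℚ)).toAffine.Point, (2 : ℤ) ^ 2 • τ = 0 →
        τ = 0 ∨ τ = Affine.Point.some (x₄ : ℚ) (y₄ : ℚ) (nonsingular_rat_of_eq V hΔ h₄) ∨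
          τ = Affine.Point.some (x₄ : ℚ) (y₄ : ℚ) (nonsingular_rat_of_eq V hΔ h₄) +
              Affine.Point.some (x₄ : ℚ) (y₄ : ℚ) (nonsingular_rat_of_eq V hΔ h₄) ∨
          τ = -Affine.Point.some (x₄ : ℚ) (y₄ : ℚ) (nonsingular_rat_of_eq V hΔ h₄) := by
  cases ℓ₁ with
  | zero => simp [fourTorsionPointB] at h₁
  | succ ℓ₁ =>
  simp only [fourTorsionPointB, Bool.and_eq_true, decide_eq_true_eq] at h₁
  obtain ⟨⟨⟨⟨⟨hT, hT2, h₄, hodd⟩, htan⟩, hg₁⟩, hB₁⟩, hB₂⟩ := h₁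
  obtain ⟨hp₁, hℓ₁⟩ := goodPrimeB_sound hg₁
  haveI : Fact (ℓ₁ + 1).Prime := ⟨hp₁⟩
  exact ⟨h₄, fourTorsion_eq V hT hT2 h₄ htan (ℓ₁ + 1) hℓ₁ hodd hB₁ hB₂⟩

end TorsionSoundness

/-! ### Shifted coset witnesses with the prime as a datum -/

/-- SHIFTED WITNESS for one point (a Boolean for `decide`): `q` good and `tCosetFree` for
`(X, Y)` w.r.t. the shift point `(x_S, y_S)`, `(A, B) ≡ (X, Y) + (x_S, y_S) (mod q)` its chord
datum; `q = 0` rejected. [cite: CremonaAlgorithms1997, §3.5] -/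
def tWitnessB (V : WeierstrassCurve ℤ) (xS yS : ℤ) : ℕ → ℤ → ℤ → ℤ → ℤ → Bool
  | 0, _, _, _, _ => false
  | q + 1, X, Y, A, B => goodPrimeB V (q + 1) &&
      tCosetFree V (q + 1) (xS : ZMod (q + 1)) (yS : ZMod (q + 1)) (X : ZMod (q + 1))
        (Y : ZMod (q + 1)) (A : ZMod (q + 1)) (B : ZMod (q + 1))

/-- SHIFTED WITNESS for a sum of two points (a Boolean for `decide`): `q` good, the chord
`(X₁,Y₁) + (X₂,Y₂) = (X₃,Y₃)` modulo `q` (`zmodChord`), and `tCosetFree` for `(X₃, Y₃)` with chord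
datum `(A, B)`. [cite: CremonaAlgorithms1997, §3.5] -/
def tWitness₂B (V : WeierstrassCurve ℤ) (xS yS : ℤ) :
    ℕ → ℤ → ℤ → ℤ → ℤ → ℤ → ℤ → ℤ → ℤ → Bool
  | 0, _, _, _, _, _, _, _, _ => false
  | q + 1, X₁, Y₁, X₂, Y₂, X₃, Y₃, A, B => goodPrimeB V (q + 1) &&
      zmodChord V (q + 1) (X₁ : ZMod (q + 1)) (Y₁ : ZMod (q + 1)) (X₂ : ZMod (q + 1))
        (Y₂ : ZMod (q + 1)) (X₃ : ZMod (q + 1)) (Y₃ : ZMod (q + 1)) &&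
      tCosetFree V (q + 1) (xS : ZMod (q + 1)) (yS : ZMod (q + 1)) (X₃ : ZMod (q + 1))
        (Y₃ : ZMod (q + 1)) (A : ZMod (q + 1)) (B : ZMod (q + 1))

/-- SHIFTED WITNESS for a sum of three points (a Boolean for `decide`): `q` good, chords
`(X₁,Y₁) + (X₂,Y₂) = (X₀,Y₀)`, `(X₀,Y₀) + (X₃,Y₃) = (X₄,Y₄)` modulo `q`, and `tCosetFree` for
`(X₄, Y₄)` with chord datum `(A, B)`. [cite: CremonaAlgorithms1997, §3.5] -/
def tWitness₃B (V : WeierstrassCurve ℤ) (xS yS : ℤ) :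
    ℕ → ℤ → ℤ → ℤ → ℤ → ℤ → ℤ → ℤ → ℤ → ℤ → ℤ → ℤ → ℤ → Bool
  | 0, _, _, _, _, _, _, _, _, _, _, _, _ => false
  | q + 1, X₁, Y₁, X₂, Y₂, X₀, Y₀, X₃, Y₃, X₄, Y₄, A, B => goodPrimeB V (q + 1) &&
      zmodChord V (q + 1) (X₁ : ZMod (q + 1)) (Y₁ : ZMod (q + 1)) (X₂ : ZMod (q + 1))
        (Y₂ : ZMod (q + 1)) (X₀ : ZMod (q + 1)) (Y₀ : ZMod (q + 1)) &&
      zmodChord V (q + 1) (X₀ : ZMod (q + 1)) (Y₀ : ZMod (q + 1)) (X₃ : ZMod (q + 1))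
        (Y₃ : ZMod (q + 1)) (X₄ : ZMod (q + 1)) (Y₄ : ZMod (q + 1)) &&
      tCosetFree V (q + 1) (xS : ZMod (q + 1)) (yS : ZMod (q + 1)) (X₄ : ZMod (q + 1))
        (Y₄ : ZMod (q + 1)) (A : ZMod (q + 1)) (B : ZMod (q + 1))

/-! The LANE HYPOTHESIS `hL` for the shifted witnesses (stated inline, no `Prop` definition): at
every good prime `q`, a rational point `R` whose reduction passes `tCosetFree` w.r.t. the reduction
of the shift point `(x_S, y_S)` lies outside `2E(ℚ) + E(ℚ)[2^u]`. It holds for `u = 1` with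
`S = T`, `E(ℚ)[2] = {O, T}` (`tShiftLane_one`), and for `u = 2` with `S = T₄`,
`E(ℚ)[4] = {O, ±T₄, T}` (`tShiftLane_two`). -/

section ShiftSoundness

variable (V : WeierstrassCurve ℤ)

open scoped Classical in
/-- Lane `u = 1`, shift `T`: from `E(ℚ)[2] ⊆ {O, T}` (`not_mem_twoCoset_one_of_tCosetFree`).
[cite: SilvermanAEC2009, Prop. VII.3.1(b)] -/
theorem tShiftLane_one {xT yT : ℤ}
    (hT : yT ^ 2 + V.a₁ * xT * yT + V.a₃ * yT = xT ^ 3 + V.a₂ * xT ^ 2 + V.a₄ * xT + V.a₆)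
    {hnsT : (V.map (Int.castRingHom ℚ)).toAffine.Nonsingular (xT : ℚ) (yT : ℚ)}
    (h2 : ∀ τ : (V.map (Int.castRingHom ℚ)).toAffine.Point, (2 : ℤ) • τ = 0 →
      τ = 0 ∨ τ = Affine.Point.some (xT : ℚ) (yT : ℚ) hnsT) :
    ∀ (q : ℕ) [Fact q.Prime] (hq : ¬ (q : ℤ) ∣ V.Δ)
      (R : (V.map (Int.castRingHom ℚ)).toAffine.Point) {α β α' β' : ZMod q}
      {hns : (V.map (Int.castRingHom (ZMod q))).toAffine.Nonsingular α β},
      reduceMod V q hq R = .some α β hns →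
      tCosetFree V q (xT : ZMod q) (yT : ZMod q) α β α' β' = true →
      R ∉ twoCoset (V.map (Int.castRingHom ℚ)).toAffine.Point 1 := by
  intro q _ hq R α β α' β' hns hR hfree
  have eT : V.toAffine.Equation xT yT := (Affine.equation_iff xT yT).mpr hT
  exact not_mem_twoCoset_one_of_tCosetFree V q hq h2 (reduceMod_some V q hq eT _) hR hfree

open scoped Classical in
/-- Lane `u = 2`, shift `T₄`: from `E(ℚ)[4] ⊆ {O, T₄, 2T₄, −T₄}`
(`not_mem_twoCoset_two_of_tCosetFree`). [cite: SilvermanAEC2009, Prop. VII.3.1(b)] -/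
theorem tShiftLane_two (hΔ : V.Δ ≠ 0) {x₄ y₄ : ℤ}
    (h₄ : y₄ ^ 2 + V.a₁ * x₄ * y₄ + V.a₃ * y₄ = x₄ ^ 3 + V.a₂ * x₄ ^ 2 + V.a₄ * x₄ + V.a₆)
    {hns₄ : (V.map (Int.castRingHom ℚ)).toAffine.Nonsingular (x₄ : ℚ) (y₄ : ℚ)}
    (h4 : haveI := isElliptic_rat V hΔ
      ∀ τ : (V.map (Int.castRingHom ℚ)).toAffine.Point, (2 : ℤ) ^ 2 • τ = 0 →
        τ = 0 ∨ τ = Affine.Point.some (x₄ : ℚ) (y₄ : ℚ) hns₄ ∨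
          τ = Affine.Point.some (x₄ : ℚ) (y₄ : ℚ) hns₄ + Affine.Point.some (x₄ : ℚ) (y₄ : ℚ) hns₄ ∨
          τ = -Affine.Point.some (x₄ : ℚ) (y₄ : ℚ) hns₄) :
    ∀ (q : ℕ) [Fact q.Prime] (hq : ¬ (q : ℤ) ∣ V.Δ)
      (R : (V.map (Int.castRingHom ℚ)).toAffine.Point) {α β α' β' : ZMod q}
      {hns : (V.map (Int.castRingHom (ZMod q))).toAffine.Nonsingular α β},
      reduceMod V q hq R = .some α β hns →
      tCosetFree V q (x₄ : ZMod q) (y₄ : ZMod q) α β α' β' = true →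
      R ∉ twoCoset (V.map (Int.castRingHom ℚ)).toAffine.Point 2 := by
  intro q _ hq R α β α' β' hns hR hfree
  have e₄ : V.toAffine.Equation x₄ y₄ := (Affine.equation_iff x₄ y₄).mpr h₄
  exact not_mem_twoCoset_two_of_tCosetFree V q hq h4 (reduceMod_some V q hq e₄ _) hR hfree

variable {V} {u : ℕ} {xS yS : ℤ}
  (hL : ∀ (q : ℕ) [Fact q.Prime] (hq : ¬ (q : ℤ) ∣ V.Δ)
    (R : (V.map (Int.castRingHom ℚ)).toAffine.Point) {α β α' β' : ZMod q}
    {hns : (V.map (Int.castRingHom (ZMod q))).toAffine.Nonsingular α β},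
    reduceMod V q hq R = .some α β hns →
    tCosetFree V q (xS : ZMod q) (yS : ZMod q) α β α' β' = true →
    R ∉ twoCoset (V.map (Int.castRingHom ℚ)).toAffine.Point u)

/-- A passing shifted witness names a good prime, so `Δ(V) ≠ 0`. [folklore] -/
theorem Δ_ne_zero_of_tWitnessB {q : ℕ} {X Y A B : ℤ} (hw : tWitnessB V xS yS q X Y A B = true) :
    V.Δ ≠ 0 := by
  cases q with
  | zero => simp [tWitnessB] at hw
  | succ q =>
    simp only [tWitnessB, Bool.and_eq_true] at hw
    exact Δ_ne_zero_of_not_dvd V (goodPrimeB_sound hw.1).2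

include hL

open scoped Classical in
/-- **Soundness of `tWitnessB`** under the lane hypothesis: the integral point `(X, Y)` lies
outside `2E(ℚ) + E(ℚ)[2^u]`. [cite: SilvermanAEC2009, Prop. VII.3.1(b)] -/
theorem not_mem_twoCoset_of_tWitnessB {q : ℕ} {X Y A B : ℤ}
    (hw : tWitnessB V xS yS q X Y A B = true) (hXY : V.toAffine.Equation X Y)
    (h : (V.map (Int.castRingHom ℚ)).toAffine.Nonsingular (X : ℚ) (Y : ℚ)) :
    (Affine.Point.some (X : ℚ) (Y : ℚ) h : (V.map (Int.castRingHom ℚ)).toAffine.Point) ∉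
      twoCoset (V.map (Int.castRingHom ℚ)).toAffine.Point u := by
  cases q with
  | zero => simp [tWitnessB] at hw
  | succ q =>
    simp only [tWitnessB, Bool.and_eq_true] at hw
    obtain ⟨hg, hfree⟩ := hw
    obtain ⟨hp, hΔ⟩ := goodPrimeB_sound hg
    haveI : Fact (q + 1).Prime := ⟨hp⟩
    exact hL (q + 1) hΔ _ (reduceMod_some V (q + 1) hΔ hXY h) hfree

open scoped Classical in
/-- **Soundness of `tWitness₂B`** under the lane hypothesis: `(X₁, Y₁) + (X₂, Y₂)` lies outside
`2E(ℚ) + E(ℚ)[2^u]` (the sum after reduction by the certified chord).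
[cite: SilvermanAEC2009, Prop. VII.3.1(b)] -/
theorem not_mem_twoCoset_of_tWitness₂B {q : ℕ}
    {X₁ Y₁ X₂ Y₂ X₃ Y₃ A B : ℤ} (hw : tWitness₂B V xS yS q X₁ Y₁ X₂ Y₂ X₃ Y₃ A B = true)
    (e₁ : V.toAffine.Equation X₁ Y₁) (e₂ : V.toAffine.Equation X₂ Y₂)
    (h₁ : (V.map (Int.castRingHom ℚ)).toAffine.Nonsingular (X₁ : ℚ) (Y₁ : ℚ))
    (h₂ : (V.map (Int.castRingHom ℚ)).toAffine.Nonsingular (X₂ : ℚ) (Y₂ : ℚ)) :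
    (Affine.Point.some (X₁ : ℚ) (Y₁ : ℚ) h₁ : (V.map (Int.castRingHom ℚ)).toAffine.Point) +
        Affine.Point.some (X₂ : ℚ) (Y₂ : ℚ) h₂ ∉
      twoCoset (V.map (Int.castRingHom ℚ)).toAffine.Point u := by
  cases q with
  | zero => simp [tWitness₂B] at hw
  | succ q =>
    simp only [tWitness₂B, Bool.and_eq_true] at hw
    obtain ⟨⟨hg, hc⟩, hfree⟩ := hw
    obtain ⟨hp, hΔ⟩ := goodPrimeB_sound hg
    haveI : Fact (q + 1).Prime := ⟨hp⟩
    obtain ⟨h', e⟩ := exists_some_add_some_of_zmodChord V (q + 1)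
      (nonsingular_zmod_of_equation V (q + 1) hΔ e₁) (nonsingular_zmod_of_equation V (q + 1) hΔ e₂)
      hc
    refine hL (q + 1) hΔ _ (hns := h') ?_ hfree
    rw [map_add, reduceMod_some V (q + 1) hΔ e₁, reduceMod_some V (q + 1) hΔ e₂, e]

open scoped Classical in
/-- **Soundness of `tWitness₃B`** under the lane hypothesis: `(X₁, Y₁) + (X₂, Y₂) + (X₃, Y₃)`
lies outside `2E(ℚ) + E(ℚ)[2^u]` (two certified chords after reduction).
[cite: SilvermanAEC2009, Prop. VII.3.1(b)] -/
theorem not_mem_twoCoset_of_tWitness₃B {q : ℕ}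
    {X₁ Y₁ X₂ Y₂ X₀ Y₀ X₃ Y₃ X₄ Y₄ A B : ℤ}
    (hw : tWitness₃B V xS yS q X₁ Y₁ X₂ Y₂ X₀ Y₀ X₃ Y₃ X₄ Y₄ A B = true)
    (e₁ : V.toAffine.Equation X₁ Y₁) (e₂ : V.toAffine.Equation X₂ Y₂)
    (e₃ : V.toAffine.Equation X₃ Y₃)
    (h₁ : (V.map (Int.castRingHom ℚ)).toAffine.Nonsingular (X₁ : ℚ) (Y₁ : ℚ))
    (h₂ : (V.map (Int.castRingHom ℚ)).toAffine.Nonsingular (X₂ : ℚ) (Y₂ : ℚ))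
    (h₃ : (V.map (Int.castRingHom ℚ)).toAffine.Nonsingular (X₃ : ℚ) (Y₃ : ℚ)) :
    (Affine.Point.some (X₁ : ℚ) (Y₁ : ℚ) h₁ : (V.map (Int.castRingHom ℚ)).toAffine.Point) +
        Affine.Point.some (X₂ : ℚ) (Y₂ : ℚ) h₂ + Affine.Point.some (X₃ : ℚ) (Y₃ : ℚ) h₃ ∉
      twoCoset (V.map (Int.castRingHom ℚ)).toAffine.Point u := by
  cases q with
  | zero => simp [tWitness₃B] at hw
  | succ q =>
    simp only [tWitness₃B, Bool.and_eq_true] at hw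
    obtain ⟨⟨⟨hg, hc⟩, hc'⟩, hfree⟩ := hw
    obtain ⟨hp, hΔ⟩ := goodPrimeB_sound hg
    haveI : Fact (q + 1).Prime := ⟨hp⟩
    obtain ⟨h', e⟩ := exists_some_add_some_of_zmodChord V (q + 1)
      (nonsingular_zmod_of_equation V (q + 1) hΔ e₁) (nonsingular_zmod_of_equation V (q + 1) hΔ e₂)
      hc
    obtain ⟨h'', e'⟩ := exists_some_add_some_of_zmodChord V (q + 1) h'
      (nonsingular_zmod_of_equation V (q + 1) hΔ e₃) hc'
    refine hL (q + 1) hΔ _ (hns := h'') ?_ hfree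
    rw [map_add, map_add, reduceMod_some V (q + 1) hΔ e₁, reduceMod_some V (q + 1) hΔ e₂,
      reduceMod_some V (q + 1) hΔ e₃, e, e']

end ShiftSoundness

end Summit.BirchSwinnertonDyer.BirchSwinnertonDyer.Rank2Observatory
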